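import Mathlib.GroupTheory.PGroup
import Mathlib.GroupTheory.Index
import Mathlib.Data.Nat.Choose.Factorization
import Mathlib.Data.Nat.Choose.Sum
import Mathlib.Tactic.Abel
import Literature.GroupTheory.CombinatorialGroupTheory.FreeGroupFiniteNilpotentQuotients

/-!
# Free groups are residually `p`

Topic `Literature/GroupTheory/CombinatorialGroupTheory`; theorems only.  For a prime `p`, a free
group `F(ι)` (any alphabet) and `w ≠ 1` there is a NORMAL subgroup `N ⊴ F(ι)` of index a power of
`p` with `w ∉ N` (`FreeGroup.exists_normal_index_prime_pow_notMem`); equivalently `F(ι)` injects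
into its pro-`p` completion (Lyndon–Schupp, *Combinatorial Group Theory*, Ch. I §10, after
Prop. 10.2; Ribes–Zalesskii, *Profinite Groups*, Prop. 3.3.15 — the form quoted as
[SemiAnbd] Remark 1.7.1).

Proof.  As for residual finite-nilpotence (`FreeGroupFiniteNilpotentQuotients.lean`): the
truncated Magnus representation `ρ : F(ι) → U := unipotent R ι n` (`MagnusTruncated.lean`) at the
truncation length `n = |w| + 1`, now over `R = ℤ/p^k` with `p^k` exceeding the non-zero integer
leading coefficient `c` of `Magnus.key_coeff`, does not kill `w`.  NEW INPUT: over `ℤ/p^k` the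
unipotent group `U` is a `p`-GROUP — every `u = 1 + N ∈ U` satisfies `u^{p^{k+n}} = 1`, because
`N^i = 0` for `i ≥ n` (the length filtration has `n` steps) while for `1 ≤ i < n` the binomial
coefficient `C(p^{k+n}, i)` is divisible by `p^k` (`Nat.factorization_choose_prime_pow`:
`v_p C(p^m, i) = m - v_p(i) ≥ m - i + 1`).  Hence the kernel of `ρ` has index `|ρ(F)|`, a power of
`p` (Lagrange in the finite `p`-group `U`).

## References

* R. C. Lyndon, P. E. Schupp, *Combinatorial Group Theory*, Springer (1977/2001), Ch. I §10.
  [LyndonSchupp2001]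
* L. Ribes, P. Zalesskii, *Profinite Groups*, Springer (2000/2010), Prop. 3.3.15.
-/

noncomputable section

namespace Literature.GroupTheory.CombinatorialGroupTheory

namespace MagnusTrunc

universe u

/-! ## Over `ℤ/p^k` the unipotent group of the length filtration is a `p`-group -/

/-- Binomial coefficients `C(p^(k+n), i)` with `1 ≤ i < n` vanish in `ℤ/p^k`: their `p`-adic
valuation is `(k+n) - v_p(i) > k`. [cite: LyndonSchupp2001, Ch. I Prop. 10.2] -/
theorem choose_prime_pow_cast_eq_zero {p : ℕ} (hp : p.Prime) (k n i : ℕ) (hi0 : i ≠ 0) (hin : i < n) :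
    (((p ^ (k + n)).choose i : ℕ) : ZMod (p ^ k)) = 0 := by
  rw [ZMod.natCast_eq_zero_iff]
  have hile : i ≤ p ^ (k + n) := (hin.trans (lt_of_le_of_lt (Nat.le_add_left n k)
    (Nat.lt_pow_self hp.one_lt))).le
  have hfac := Nat.factorization_choose_prime_pow hp hile hi0
  have hlt := Nat.factorization_lt p hi0
  have hne : (p ^ (k + n)).choose i ≠ 0 := (Nat.choose_pos hile).ne'
  rw [hp.pow_dvd_iff_le_factorization hne, hfac]
  omega

/-- Over `R = ℤ/p^k`, every element `u` of the unipotent group of the length-`n` filtration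
satisfies `u ^ (p ^ (k + n)) = 1`: write `u = 1 + N`; `N^i = 0` for `i ≥ n` and the remaining
binomial coefficients vanish in `ℤ/p^k`. [cite: LyndonSchupp2001, Ch. I Prop. 10.2] -/
theorem unipotent_pow_eq_one {p : ℕ} (hp : p.Prime) (k : ℕ) {ι : Type u} {n : ℕ}
    (u : unipotent (ZMod (p ^ k)) ι n) : u ^ (p ^ (k + n)) = 1 := by
  apply Subtype.ext
  apply Units.ext
  rw [SubmonoidClass.coe_pow, Units.val_pow_eq_pow_val, OneMemClass.coe_one, Units.val_one]
  set U : Module.End (ZMod (p ^ k)) (V (ZMod (p ^ k)) ι n) :=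
    ((u : (Module.End (ZMod (p ^ k)) (V (ZMod (p ^ k)) ι n))ˣ) :
      Module.End (ZMod (p ^ k)) (V (ZMod (p ^ k)) ι n)) with hUdef
  set N := U - 1 with hNdef
  have hU : U = N + 1 := by rw [hNdef]; abel
  -- `N^i` maps everything into `F i`
  have hN : ∀ (i : ℕ) (x : V (ZMod (p ^ k)) ι n), (N ^ i) x ∈ F i := by
    intro i
    induction i with
    | zero =>
      intro x
      rw [pow_zero, Module.End.one_apply]
      exact mem_F_zero x
    | succ i ih =>
      intro x
      rw [pow_succ', Module.End.mul_apply, hNdef, LinearMap.sub_apply, Module.End.one_apply]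
      exact (u.2 i _ (ih x)).1
  have hNn : ∀ i : ℕ, n ≤ i → N ^ i = 0 := fun i hi =>
    LinearMap.ext fun x => eq_zero_of_mem_F hi (hN i x)
  rw [hU, Commute.add_pow (Commute.one_right N), Finset.sum_eq_single 0]
  · simp
  · intro i _ hi0
    by_cases hin : i < n
    · -- the binomial coefficient vanishes in `ℤ/p^k`
      have hc : (((p ^ (k + n)).choose i : ℕ) : Module.End (ZMod (p ^ k)) (V (ZMod (p ^ k)) ι n)) = 0 := by
        refine LinearMap.ext fun x => ?_
        rw [Module.End.natCast_apply, ← Nat.cast_smul_eq_nsmul (ZMod (p ^ k)),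
          choose_prime_pow_cast_eq_zero hp k n i hi0 hin, zero_smul, LinearMap.zero_apply]
      rw [hc, mul_zero]
    · rw [hNn i (by omega), zero_mul, zero_mul]
  · intro h
    exact absurd (Finset.mem_range.mpr (Nat.pos_of_ne_zero (by positivity))) h

/-- Over `ℤ/p^k` the unipotent group of the length filtration is a `p`-group.
[cite: LyndonSchupp2001, Ch. I Prop. 10.2] -/
theorem isPGroup_unipotent {p : ℕ} (hp : p.Prime) (k : ℕ) (ι : Type u) (n : ℕ) :
    IsPGroup p (unipotent (ZMod (p ^ k)) ι n) :=
  fun u => ⟨k + n, unipotent_pow_eq_one hp k u⟩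

/-! ## Non-vanishing over `ℤ/p^k` and the main theorem -/

/-- **Free groups on a finite alphabet are residually `p`.**  For a prime `p` and `w ≠ 1` in
`F(ι)`, `ι` finite, there is a homomorphism to a finite `p`-group not killing `w` — the truncated
Magnus representation over `ℤ/p^k` for `p^k` larger than the integral leading coefficient of
`ρ_ℤ(w) e_∅`. [cite: LyndonSchupp2001, Ch. I Prop. 10.2] -/
theorem _root_.FreeGroup.exists_finite_pGroup_map_ne_one_of_finite {p : ℕ} (hp : p.Prime)
    {ι : Type u} [Finite ι] (w : FreeGroup ι) (hw : w ≠ 1) :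
    ∃ (Q : Type u) (_ : Group Q) (_ : Finite Q) (_ : IsPGroup p Q) (φ : FreeGroup ι →* Q),
      φ w ≠ 1 := by
  classical
  set n := w.toWord.length + 1 with hn
  -- the integral leading coefficient
  obtain ⟨key, c, hc, hklen, hhead, hcoef, -⟩ :=
    Magnus.key_coeff n w.toWord.length w.toWord le_rfl (Nat.lt_succ_self _) FreeGroup.isReduced_toWord
  rw [FreeGroup.mk_toWord] at hcoef
  have hkey : key ≠ [] := by
    intro hk
    rw [hk] at hhead
    have hne : w.toWord ≠ [] := fun h' => hw (FreeGroup.toWord_eq_nil_iff.1 h')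
    obtain ⟨q, L, hqL⟩ := List.exists_cons_of_ne_nil hne
    rw [hqL] at hhead
    simp at hhead
  have hklt : key.length < n := by omega
  -- coefficients modulo `p^k` with `p^k > |c|`
  set k := c.natAbs with hk
  have hcm : ((c : ℤ) : ZMod (p ^ k)) ≠ 0 := by
    rw [Ne, ZMod.intCast_zmod_eq_zero_iff_dvd]
    intro hdvd
    refine hc (Int.eq_zero_of_dvd_of_natAbs_lt_natAbs hdvd ?_)
    rw [Int.natAbs_natCast]
    exact Nat.lt_pow_self hp.one_lt
  haveI : NeZero (p ^ k) := ⟨(pow_pos hp.pos k).ne'⟩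
  refine ⟨unipotent (ZMod (p ^ k)) ι n, inferInstance, finite_unipotent, isPGroup_unipotent hp k ι n,
    rhoU (ZMod (p ^ k)) n, fun h1 => ?_⟩
  have h2 : ((rho (ZMod (p ^ k)) n w : (Module.End (ZMod (p ^ k)) (V (ZMod (p ^ k)) ι n))ˣ) :
      Module.End (ZMod (p ^ k)) (V (ZMod (p ^ k)) ι n)) = 1 := by
    rw [← coe_rhoU, h1]; rfl
  -- evaluate at the empty word and read off the coefficient at `key`
  have h3 := congrArg (fun v => v ⟨key, hklt⟩)
    (red_rho_apply (ZMod (p ^ k)) n w (Finsupp.single [] 1))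
  simp only [h2, Module.End.one_apply, red_apply, hcoef] at h3
  rw [Finsupp.single_apply, if_neg (fun e => hkey e.symm), Int.cast_zero] at h3
  exact hcm h3

/-- **Free groups are residually `p`** (any alphabet): for a prime `p` and `w ≠ 1` in `F(ι)`
there is a homomorphism to a finite `p`-group not killing `w` (restriction to the finite alphabet
of `w`, then the finite case). [cite: LyndonSchupp2001, Ch. I Prop. 10.2] -/
theorem _root_.FreeGroup.exists_finite_pGroup_map_ne_one {p : ℕ} (hp : p.Prime) {ι : Type u}
    (w : FreeGroup ι) (hw : w ≠ 1) :
    ∃ (Q : Type u) (_ : Group Q) (_ : Finite Q) (_ : IsPGroup p Q) (φ : FreeGroup ι →* Q),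
      φ w ≠ 1 := by
  classical
  let S : Finset ι := (w.toWord.map Prod.fst).toFinset
  let ψ : FreeGroup ι →* FreeGroup (S : Set ι) :=
    FreeGroup.lift fun i => if h : i ∈ S then FreeGroup.of ⟨i, h⟩ else 1
  let back : FreeGroup (S : Set ι) →* FreeGroup ι := FreeGroup.lift fun i => FreeGroup.of (i : ι)
  have hback : ∀ v ∈ Subgroup.closure (FreeGroup.of '' (S : Set ι)), back (ψ v) = v := by
    intro v hv
    induction hv using Subgroup.closure_induction with
    | mem v hv =>
      obtain ⟨i, hi, rfl⟩ := hv
      have hi' : i ∈ S := hi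
      simp [ψ, back, hi']
    | one => simp
    | mul a b _ _ ha hb => rw [map_mul, map_mul, ha, hb]
    | inv a _ ha => rw [map_inv, map_inv, ha]
  have hwmem : w ∈ Subgroup.closure (FreeGroup.of '' (S : Set ι)) := by
    rw [← FreeGroup.mk_toWord (x := w)]
    exact mk_mem_closure_of_letters (S : Set ι) w.toWord fun x hx => by
      simp only [Finset.mem_coe, List.mem_toFinset, List.mem_map, S]
      exact ⟨x, hx, rfl⟩
  have hψw : ψ w ≠ 1 := fun h => hw (by rw [← hback w hwmem, h, map_one])
  obtain ⟨Q, _, _, hQ, φ, hφ⟩ := FreeGroup.exists_finite_pGroup_map_ne_one_of_finite hp (ψ w) hψw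
  exact ⟨Q, inferInstance, inferInstance, hQ, φ.comp ψ, hφ⟩

/-- **Free groups are residually `p`, normal-subgroup form**: for a prime `p` and `w ≠ 1` in a
free group there is a normal subgroup of `p`-power index avoiding `w` — the kernel of a map to a
finite `p`-group not killing `w`. [cite: LyndonSchupp2001, Ch. I Prop. 10.2] -/
theorem _root_.FreeGroup.exists_normal_index_prime_pow_notMem {p : ℕ} (hp : p.Prime) {ι : Type u}
    (w : FreeGroup ι) (hw : w ≠ 1) :
    ∃ (N : Subgroup (FreeGroup ι)) (k : ℕ), N.Normal ∧ N.index = p ^ k ∧ w ∉ N := by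
  obtain ⟨Q, _, _, hQ, φ, hφ⟩ := FreeGroup.exists_finite_pGroup_map_ne_one hp w hw
  haveI : Fact p.Prime := ⟨hp⟩
  obtain ⟨k, hk⟩ := IsPGroup.iff_card.mp (hQ.to_subgroup φ.range)
  refine ⟨φ.ker, k, inferInstance, ?_, fun h => hφ ((MonoidHom.mem_ker).mp h)⟩
  rw [Subgroup.index_ker, hk]

end MagnusTrunc

end Literature.GroupTheory.CombinatorialGroupTheory

end
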